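import Mathlib.NumberTheory.Divisors
import Mathlib.Tactic.Ring
import Mathlib.Tactic.NormNum
import HarnessLib

/-!
# Cube part sizes at `|A| = 784` (`ℤ_7²` quotient): ordered factorisations of `261` (arithmetic for `DihedralLawModOneOrder784`)

ω-census `pub-omega`, family (b3), seat pub-omega-group gen 39.  Framing: lottery ticket; floor = certified bounds/negative ranges.
VALUE: bookkeeping (pure arithmetic); NOT progress on ω.
-/

namespace Summit.MatrixMultiplication.OmegaCensus

/-- The cube part sizes at `|A| = 784`: `cde = 261`, all `18` ordered factorisations. [folklore] -/
theorem cube_factor_of_784_ordered {c d e : ℕ} (h : 3 * (c * d * e) + 1 = 784) :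
    (c = 1 ∧ d = 1 ∧ e = 261) ∨
      (c = 1 ∧ d = 3 ∧ e = 87) ∨
      (c = 1 ∧ d = 9 ∧ e = 29) ∨
      (c = 1 ∧ d = 29 ∧ e = 9) ∨
      (c = 1 ∧ d = 87 ∧ e = 3) ∨
      (c = 1 ∧ d = 261 ∧ e = 1) ∨
      (c = 3 ∧ d = 1 ∧ e = 87) ∨
      (c = 3 ∧ d = 3 ∧ e = 29) ∨
      (c = 3 ∧ d = 29 ∧ e = 3) ∨
      (c = 3 ∧ d = 87 ∧ e = 1) ∨
      (c = 9 ∧ d = 1 ∧ e = 29) ∨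
      (c = 9 ∧ d = 29 ∧ e = 1) ∨
      (c = 29 ∧ d = 1 ∧ e = 9) ∨
      (c = 29 ∧ d = 3 ∧ e = 3) ∨
      (c = 29 ∧ d = 9 ∧ e = 1) ∨
      (c = 87 ∧ d = 1 ∧ e = 3) ∨
      (c = 87 ∧ d = 3 ∧ e = 1) ∨
      (c = 261 ∧ d = 1 ∧ e = 1) := by
  have hcde : c * (d * e) = 261 := by rw [← mul_assoc]; omega
  have hc : c ∈ Nat.divisors 261 := Nat.mem_divisors.2 ⟨Dvd.intro _ hcde, by norm_num⟩
  have hd : d ∈ Nat.divisors 261 :=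
    Nat.mem_divisors.2 ⟨Dvd.intro (c * e) (by rw [← hcde]; ring), by norm_num⟩
  rw [show Nat.divisors 261 = {1, 3, 9, 29, 87, 261} from by decide] at hc hd
  simp only [Finset.mem_insert, Finset.mem_singleton] at hc hd
  rcases hc with rfl | rfl | rfl | rfl | rfl | rfl <;> rcases hd with rfl | rfl | rfl | rfl | rfl | rfl
  · have he : e = 261 := by omega
    exact Or.inl ⟨rfl, rfl, he⟩
  · have he : e = 87 := by omega
    exact Or.inr (Or.inl ⟨rfl, rfl, he⟩)
  · have he : e = 29 := by omega
    exact Or.inr (Or.inr (Or.inl ⟨rfl, rfl, he⟩))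
  · have he : e = 9 := by omega
    exact Or.inr (Or.inr (Or.inr (Or.inl ⟨rfl, rfl, he⟩)))
  · have he : e = 3 := by omega
    exact Or.inr (Or.inr (Or.inr (Or.inr (Or.inl ⟨rfl, rfl, he⟩))))
  · have he : e = 1 := by omega
    exact Or.inr (Or.inr (Or.inr (Or.inr (Or.inr (Or.inl ⟨rfl, rfl, he⟩)))))
  · have he : e = 87 := by omega
    exact Or.inr (Or.inr (Or.inr (Or.inr (Or.inr (Or.inr (Or.inl ⟨rfl, rfl, he⟩))))))
  · have he : e = 29 := by omega
    exact Or.inr (Or.inr (Or.inr (Or.inr (Or.inr (Or.inr (Or.inr (Or.inl ⟨rfl, rfl, he⟩)))))))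
  · omega
  · have he : e = 3 := by omega
    exact Or.inr (Or.inr (Or.inr (Or.inr (Or.inr (Or.inr (Or.inr (Or.inr (Or.inl ⟨rfl, rfl, he⟩))))))))
  · have he : e = 1 := by omega
    exact Or.inr (Or.inr (Or.inr (Or.inr (Or.inr (Or.inr (Or.inr (Or.inr (Or.inr (Or.inl ⟨rfl, rfl, he⟩)))))))))
  · omega
  · have he : e = 29 := by omega
    exact Or.inr (Or.inr (Or.inr (Or.inr (Or.inr (Or.inr (Or.inr (Or.inr (Or.inr (Or.inr (Or.inl ⟨rfl, rfl, he⟩))))))))))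
  · omega
  · omega
  · have he : e = 1 := by omega
    exact Or.inr (Or.inr (Or.inr (Or.inr (Or.inr (Or.inr (Or.inr (Or.inr (Or.inr (Or.inr (Or.inr (Or.inl ⟨rfl, rfl, he⟩)))))))))))
  · omega
  · omega
  · have he : e = 9 := by omega
    exact Or.inr (Or.inr (Or.inr (Or.inr (Or.inr (Or.inr (Or.inr (Or.inr (Or.inr (Or.inr (Or.inr (Or.inr (Or.inl ⟨rfl, rfl, he⟩))))))))))))
  · have he : e = 3 := by omega
    exact Or.inr (Or.inr (Or.inr (Or.inr (Or.inr (Or.inr (Or.inr (Or.inr (Or.inr (Or.inr (Or.inr (Or.inr (Or.inr (Or.inl ⟨rfl, rfl, he⟩)))))))))))))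
  · have he : e = 1 := by omega
    exact Or.inr (Or.inr (Or.inr (Or.inr (Or.inr (Or.inr (Or.inr (Or.inr (Or.inr (Or.inr (Or.inr (Or.inr (Or.inr (Or.inr (Or.inl ⟨rfl, rfl, he⟩))))))))))))))
  · omega
  · omega
  · omega
  · have he : e = 3 := by omega
    exact Or.inr (Or.inr (Or.inr (Or.inr (Or.inr (Or.inr (Or.inr (Or.inr (Or.inr (Or.inr (Or.inr (Or.inr (Or.inr (Or.inr (Or.inr (Or.inl ⟨rfl, rfl, he⟩)))))))))))))))
  · have he : e = 1 := by omega
    exact Or.inr (Or.inr (Or.inr (Or.inr (Or.inr (Or.inr (Or.inr (Or.inr (Or.inr (Or.inr (Or.inr (Or.inr (Or.inr (Or.inr (Or.inr (Or.inr (Or.inl ⟨rfl, rfl, he⟩))))))))))))))))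
  · omega
  · omega
  · omega
  · omega
  · have he : e = 1 := by omega
    exact Or.inr (Or.inr (Or.inr (Or.inr (Or.inr (Or.inr (Or.inr (Or.inr (Or.inr (Or.inr (Or.inr (Or.inr (Or.inr (Or.inr (Or.inr (Or.inr (Or.inr (⟨rfl, rfl, he⟩)))))))))))))))))
  · omega
  · omega
  · omega
  · omega
  · omega

end Summit.MatrixMultiplication.OmegaCensus
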